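import Summits.BirchSwinnertonDyer.Rank1Residual.X11b.Three.RangeGaloisTransport
import Literature.NumberTheory.EllipticCurves.AnticyclotomicRankinSelbergPAdicLFunction
import Mathlib.FieldTheory.Galois.Infinite
import HarnessLib

/-!
# X11b @ `p = 3`, S29 K4a (prelude to K4): the witness normal form and two Galois bookkeeping lemmas

HONEST FRAMING (cell `b2b-bsdres`, run/shared/lean/b2b/bsd-rank1-residual/, verbatim in every
file): the goal of the cell is to DELETE the COMBINATION-SHAPED residual classes of the
Birch–Swinnerton-Dyer formula for ALL analytic-rank `≤ 1` elliptic curves over `ℚ` — assembled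
STRICTLY from published theorems — so that the rank-`≤ 1` remainder becomes exactly the
CONSTRUCTION-SHAPED classes, which are TYPED, NOT attempted. This is not "finishing BSD". Team N8/O2
(X11b at `3`); deal S29 (x11b3-lead GEN 8, OWNERS R9-8/R9-14), package K4 prelude, seat
`b2b-bsdres-x11b3-p7` (gen. 5). WORDING OF RECORD (H45, R9-8): S29 RE-EXPRESSES (t) ⟸ (VR); this
file is unconditional bookkeeping and SUPPLIES NOTHING of the class record; the node
`Three.HsiehDescentAt₃` is UNCHANGED; O2 OPEN / N8 CONSTRUCTION; nothing booked. THEOREMS ONLY (no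
definition, no named fact, no `sorry`).

## What this file proves (plan `HOME/b2b-bsdres-x11b3-p7/s25/K4-PLAN.md` Steps 0–1)

* `bdpInterpolationValue_eq_mul_of_ne_zero` — CHANGE OF COMPLEX PERIOD: for `Ω ≠ 0`,
  `bdpIV(χ, n, Ω_K) = (Ω/Ω_K)^{4n} · bdpIV(χ, n, Ω)` (Castella's display is homogeneous of degree
  `−4n` in the period).
* `hsiehInterpolationValue_eq_mul_pow_mul` — THE WITNESS NORMAL FORM at `p ∣ N`: Hsieh's display
  `hsiehInterpolationValue p f 𝔭 χ n A Ω_K C` equals `C · (p/(16A²)·(Ω/Ω_K)⁴)ⁿ · bdpIV(χ, n, Ω)` — so the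
  witness's `A, Ω_K` (and, after `·Ω_p^{4n}`, its `Ω_p`) enter ONLY through ONE `n`-th power
  (`hsiehInterpolationValue_eq_mul_bdpInterpolationValue` of the tree, rearranged).
* `exists_algebraMap_eq_of_quadratic` — for `K/ℚ` quadratic with ONE embedding `e₀ : K →+* ℚ_p`
  (e.g. the tree's `embAt K p 𝔭 …` at a degree-one prime), EVERY embedding `e : K →+* ℚ̄_p` lands in
  `ℚ_p` (the conjugate embedding is `e₀ ∘ c`); hence `algEquiv_apply_embedding_eq`: every
  `τ ∈ Gal(ℚ̄_p/ℚ_p)` fixes `e(K)` pointwise — the hypothesis `hσK` of K1's `range_transport` for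
  `σ_τ = ι' ∘ τ ∘ ι'⁻¹`.
* `pow_mem_range_algebraMap_of_forall_div_pow_eq_one` — if every `τ ∈ Gal(ℚ̄_p/ℚ_p)` moves `u` by a
  `N`-th root of unity (`(τ u / u)^N = 1`; K1 `exists_pow_map_div_eq_one`), then `u^N ∈ ℚ_p`
  (infinite Galois theory, Mathlib `InfiniteGalois.mem_range_algebraMap_iff_fixed`).

References: [Hsieh2014] Thm. 1; [Castella2018] Thm. 3.1; cell files `cells/x11b3/OWNERS.md` R9-8, `s25/K4-PLAN.md`.
-/

noncomputable section

open scoped NumberField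
open NumberField IsDedekindDomain Field
open Literature.NumberTheory.GaloisRepresentations Literature.NumberTheory.EllipticCurves

namespace Summit.BirchSwinnertonDyer.Rank1Residual.X11b.Three.RangeTransport

universe u

/-! ### §1. The witness normal form -/

section Values

variable {K : Type u} [Field K] [NumberField K] {N : ℕ}

/-- **Change of complex period in Castella's display**: for `Ω ≠ 0`,
`bdpInterpolationValue p f 𝔭 χ n Ω_K = (Ω/Ω_K)^{4n} · bdpInterpolationValue p f 𝔭 χ n Ω`.
[cite: Castella2018, Thm. 3.1 (arXiv:1704.06608 p. 9)] -/
theorem bdpInterpolationValue_eq_mul_of_ne_zero (p : ℕ) (f : CuspForm (CongruenceSubgroup.Gamma0 N) 2)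
    (𝔭 : HeightOneSpectrum (𝓞 K)) (χ : HeckeCharacter K) (n : ℕ) {Ω : ℂ} (hΩ : Ω ≠ 0) (ΩK : ℂ) :
    bdpInterpolationValue p f 𝔭 χ n ΩK = (Ω / ΩK) ^ (4 * n) * bdpInterpolationValue p f 𝔭 χ n Ω := by
  unfold bdpInterpolationValue
  simp only
  have hΩ' : Ω ^ (4 * n) ≠ 0 := pow_ne_zero _ hΩ
  rw [div_pow]
  field_simp

/-- **The witness normal form at `p ∣ N`**: Hsieh's display equals
`C · (p/(16 A²) · (Ω/Ω_K)⁴)ⁿ · bdpInterpolationValue p f 𝔭 χ n Ω` for every `Ω ≠ 0` — the witness's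
real constant `A` and complex period `Ω_K` enter only through ONE `n`-th power.
[cite: Hsieh2014, Thm. 1 (arXiv:1112.1580 p. 4)] [cite: Castella2018, Thm. 3.1 (arXiv:1704.06608 p. 9)] -/
theorem hsiehInterpolationValue_eq_mul_pow_mul {p : ℕ} (hpN : p ∣ N)
    (f : CuspForm (CongruenceSubgroup.Gamma0 N) 2) (𝔭 : HeightOneSpectrum (𝓞 K)) (χ : HeckeCharacter K)
    (n : ℕ) (A : ℝ) (ΩK C : ℂ) {Ω : ℂ} (hΩ : Ω ≠ 0) :
    hsiehInterpolationValue p f 𝔭 χ n A ΩK C =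
      C * ((p : ℂ) / (16 * (A : ℂ) ^ 2) * (Ω / ΩK) ^ 4) ^ n * bdpInterpolationValue p f 𝔭 χ n Ω := by
  rw [hsiehInterpolationValue_eq_mul_bdpInterpolationValue, if_pos hpN,
    bdpInterpolationValue_eq_mul_of_ne_zero p f 𝔭 χ n hΩ ΩK]
  have h16 : (4 : ℂ) ^ (2 * n) = (16 : ℂ) ^ n := by
    rw [pow_mul]; norm_num
  have hA : (A : ℂ) ^ (2 * n) = ((A : ℂ) ^ 2) ^ n := pow_mul _ 2 n
  have hΩ4 : (Ω / ΩK) ^ (4 * n) = ((Ω / ΩK) ^ 4) ^ n := pow_mul _ 4 n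
  rw [h16, hA, hΩ4]
  have hdiv : ((p : ℂ) / (16 * (A : ℂ) ^ 2)) ^ n = (p : ℂ) ^ n / ((16 : ℂ) ^ n * ((A : ℂ) ^ 2) ^ n) := by
    rw [div_pow, mul_pow]
  rw [mul_pow ((p : ℂ) / (16 * (A : ℂ) ^ 2)) ((Ω / ΩK) ^ 4) n, hdiv]
  ring

end Values

/-! ### §2. Embeddings of a quadratic field into `ℚ̄_p` through `ℚ_p` -/

section Quadratic

variable {K : Type} [Field K] [NumberField K] {p : ℕ} [Fact p.Prime]

/-- **Every embedding of a quadratic `K` into `ℚ̄_p` lands in `ℚ_p` as soon as ONE embedding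
`K →+* ℚ_p` exists** (e.g. the tree's `embAt K p 𝔭 …` at a degree-one prime `𝔭 ∣ p`): `K/ℚ` is
Galois, so two embeddings into the field `ℚ̄_p` differ by an automorphism of `K`. [folklore] -/
theorem exists_algebraMap_eq_of_quadratic (hK : Module.finrank ℚ K = 2) (e₀ : K →+* ℚ_[p])
    (e : K →+* PadicAlgCl p) (k : K) :
    ∃ q : ℚ_[p], algebraMap ℚ_[p] (PadicAlgCl p) q = e k := by
  haveI : Algebra.IsQuadraticExtension ℚ K := { finrank_eq_two' := hK }
  haveI : IsGalois ℚ K := inferInstance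
  -- the two `ℚ`-algebra maps `K → ℚ̄_p`
  let ψ₀ : K →ₐ[ℚ] PadicAlgCl p := ((algebraMap ℚ_[p] (PadicAlgCl p)).comp e₀).toRatAlgHom
  let ψ : K →ₐ[ℚ] PadicAlgCl p := e.toRatAlgHom
  -- the normal intermediate field `E₀ = ψ₀(K)`
  let E₀ : IntermediateField ℚ (PadicAlgCl p) := ψ₀.fieldRange
  let i₀ : K ≃ₐ[ℚ] ψ₀.range := AlgEquiv.ofInjectiveField ψ₀
  let i : K ≃ₐ[ℚ] E₀ :=
    i₀.trans (Subalgebra.equivOfEq _ _ (AlgHom.fieldRange_toSubalgebra ψ₀).symm)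
  have hN : Normal ℚ E₀ := Normal.of_algEquiv i
  let σ' : E₀ →ₐ[ℚ] PadicAlgCl p := ψ.comp (i.symm : E₀ →ₐ[ℚ] K)
  have hσ' : σ'.fieldRange = E₀ := @AlgHom.fieldRange_of_normal ℚ (PadicAlgCl p) _ _ _ E₀ hN σ'
  have hk : ψ k ∈ σ'.fieldRange := ⟨i k, by simp [σ']⟩
  rw [hσ'] at hk
  obtain ⟨k', hk'⟩ := (AlgHom.mem_fieldRange).mp hk
  exact ⟨e₀ k', by simpa [ψ, ψ₀] using hk'⟩

/-- **Every `ℚ_p`-automorphism of `ℚ̄_p` fixes the image of a quadratic `K` pointwise** (given one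
embedding `K →+* ℚ_p`). [folklore] -/
theorem algEquiv_apply_embedding_eq (hK : Module.finrank ℚ K = 2) (e₀ : K →+* ℚ_[p])
    (τ : PadicAlgCl p ≃ₐ[ℚ_[p]] PadicAlgCl p) (e : K →+* PadicAlgCl p) (k : K) :
    τ (e k) = e k := by
  obtain ⟨q, hq⟩ := exists_algebraMap_eq_of_quadratic hK e₀ e k
  rw [← hq, AlgEquiv.commutes]

end Quadratic

/-! ### §3. Elements moved only by roots of unity have a power in the base -/

section Fixed

variable {p : ℕ} [Fact p.Prime]

/-- **If every `τ ∈ Gal(ℚ̄_p/ℚ_p)` moves `u` by an `N`-th root of unity, then `u^N ∈ ℚ_p`**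
(`τ(u^N) = (τ u)^N = u^N` and Galois theory for `ℚ̄_p/ℚ_p`, Mathlib
`InfiniteGalois.mem_range_algebraMap_iff_fixed`). Used with K1's `exists_pow_map_div_eq_one`: the
values of the avatar move by `p`-power roots of unity. [folklore] -/
theorem pow_mem_range_algebraMap_of_forall_div_pow_eq_one {u : PadicAlgCl p} (hu : u ≠ 0) {N : ℕ}
    (h : ∀ τ : PadicAlgCl p ≃ₐ[ℚ_[p]] PadicAlgCl p, (τ u / u) ^ N = 1) :
    u ^ N ∈ Set.range (algebraMap ℚ_[p] (PadicAlgCl p)) := by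
  rw [InfiniteGalois.mem_range_algebraMap_iff_fixed]
  intro τ
  have := h τ
  rw [div_pow, div_eq_one_iff_eq (pow_ne_zero _ hu)] at this
  rw [map_pow, this]

end Fixed

end Summit.BirchSwinnertonDyer.Rank1Residual.X11b.Three.RangeTransport

end
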